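import Mathlib
import Literature.AlgebraicGeometry.Resolution.FormalInverseFunction
import Summits.ResolutionOfSingularities.ResolutionOfSingularities.Theorems.WeightedInvariantLocalWeightedDropConeDichotomyAux
import Summits.ResolutionOfSingularities.ResolutionOfSingularities.Theorems.WeightedInvariantLocalWeightedDropSpaceCountGameInvariance
import Summits.ResolutionOfSingularities.ResolutionOfSingularities.Theorems.WeightedInvariantLocalWeightedDropNCGameTransport

/-!
# `LocalWeightedDrop`, line `nc-game-transport`, TOT rung R0: a unit times a monomial in ANY formal coordinate system is NC;
# NC recognition for a smooth factor transversal to a coordinate monomial; powers of one smooth germ are won at depth `0`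

[OURS · L1 W4.3 · chain w43, engine crux `LocalWeightedDrop` stmt-ResolutionOfSingularities-8899; strategist res-L1-w43-strat-1, line
`nc-game-transport` (landed transport `NCTransport.won_of_winsIn`, …NCGameTransport), rung spec `L/res-L1-w43-strat-1/TOT-RUNGS-SPEC.md`
§R0 (ORDERS-BY-NAME 07:20:08Z, R0 → res-D-pv-006).  Objects = the programme's own count game (`TameFourTupleDrop.WinsIn GermIsNC`,
…SpaceCountGame) and weighted game (`CobordantGame.Won`); NOT a statement of any manuscript.  This file closes nothing by name: R0 is the
warm-up rung whose NC-RECOGNITION LEMMAS the real rungs R2 (hyperplane arrangements) / R1 (toric) consume.]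

* `germIsNC_unit_mul_prod_pow_coords` — A UNIT TIMES A MONOMIAL IN ANY FORMAL COORDINATE SYSTEM IS NC: for a legal family
  `θ = (θ₀,…,θ_{n−1})` (zero constant terms, invertible linear part) and `u(0) ≠ 0`, `GermIsNC (u · ∏ᵢ θᵢ^{vᵢ})` — the normalising
  coordinates are the compositional inverse of `θ` (`FormalCoordChange.exists_comp_inverse`, the formal inverse function theorem).
  `germIsNC_unit_mul_prod_pow_linForms` — the linear case: `u · ∏ᵢ (∑ⱼ M i j · xⱼ)^{vᵢ}` is NC for `det M ≠ 0` (`n` linearly independent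
  linear forms; R2's terminal positions after completing an independent arrangement to a basis).
* `det_linMat_update_X`, `germIsNC_of_smooth_mul_unitMonomial` — NC RECOGNITION: the family `(x₀,…,g,…,x_{n−1})` (`g` in slot `i₀`) has
  linear part `1` with row `i₀` replaced by `g`'s linear part, determinant `∂g/∂x_{i₀}(0)`; hence for `g(0) = 0`, `∂g/∂x_{i₀}(0) ≠ 0`,
  `u(0) ≠ 0` and exponents `v` with `v_{i₀} = 0`:  `GermIsNC (u · g^e · ∏ᵢ xᵢ^{vᵢ})` («an order-`1`-in-`x_{i₀}` factor times a unit monomial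
  in the OTHER variables is NC»).
* `germIsNC_unit_mul_smoothPower`, `winsIn_zero_smoothPower`, `exists_winsIn_smoothPower`, `won_of_dvd_smoothPower_pow` — R0 PROPER:
  `order g = 1`, `u(0) ≠ 0` ⇒ `u · g^e` is NC, i.e. won at depth `0` of the count game (`WinsIn GermIsNC 0`), whence (rung shape)
  `∃ n, WinsIn GermIsNC n (u · g^e)` and — depth-`0` transport `NCTransport.won_of_germIsNC` — every divisor of a power of `u · g^e` is in
  the winning region `CobordantGame.Won k (m + 1)` of the weighted game (any field; generic number of variables).
-/

noncomputable section

open Literature.AlgebraicGeometry.Resolution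

set_option linter.dupNamespace false -- mandated namespace of this single-conjunct summit

namespace Summit.ResolutionOfSingularities.ResolutionOfSingularities.Theorems

namespace NCTransport

open MvPowerSeries TameFourTupleDrop

variable {k : Type} [Field k]

/-! ## A unit times a monomial in an arbitrary formal coordinate system -/

/-- **A UNIT TIMES A MONOMIAL IN ANY FORMAL COORDINATE SYSTEM HAS NORMAL-CROSSING SUPPORT** (OURS · L1 W4.3, rung R0): for a legal
family `θ` (zero constant terms, invertible linear part) and `u(0) ≠ 0`, `GermIsNC (u · ∏ᵢ θᵢ^{vᵢ})`; the normalising coordinates are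
the compositional inverse `ψ` of `θ` (`ψ^* θᵢ = xᵢ`, formal inverse function theorem). -/
theorem germIsNC_unit_mul_prod_pow_coords {n : ℕ} {θ : Fin n → MvPowerSeries (Fin n) k}
    (hθ0 : ∀ i, constantCoeff (θ i) = 0) (hθdet : IsUnit (Matrix.det (Matrix.of fun i j => coeff (Finsupp.single j 1) (θ i))))
    {u : MvPowerSeries (Fin n) k} (hu : constantCoeff u ≠ 0) (v : Fin n → ℕ) :
    GermIsNC (u * ∏ i, θ i ^ v i) := by
  obtain ⟨ψ, hψ0, hψθ, -⟩ := FormalCoordChange.exists_comp_inverse hθ0 hθdet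
  have hψs : HasSubst ψ := hasSubst_of_constantCoeff_zero hψ0
  refine ⟨ψ, subst ψ u, v, hψ0, isUnit_det_linMat_of_comp_eq_X hψ0 hψθ, ?_, ?_⟩
  · rw [constantCoeff_subst_of_constantCoeff_zero _ hψ0]
    exact hu
  · rw [← coe_substAlgHom hψs, map_mul, map_prod]
    refine congrArg _ (Finset.prod_congr rfl fun i _ => ?_)
    rw [map_pow, coe_substAlgHom, hψθ]

/-- The linear case: for an invertible matrix `M`, `u · ∏ᵢ (∑ⱼ M i j · xⱼ)^{vᵢ}` — a unit times powers of `n` LINEARLY INDEPENDENT LINEAR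
FORMS — has normal-crossing support. -/
theorem germIsNC_unit_mul_prod_pow_linForms {n : ℕ} {M : Matrix (Fin n) (Fin n) k} (hM : IsUnit M.det)
    {u : MvPowerSeries (Fin n) k} (hu : constantCoeff u ≠ 0) (v : Fin n → ℕ) :
    GermIsNC (u * ∏ i, FormalCoordChange.linSubst M i ^ v i) :=
  germIsNC_unit_mul_prod_pow_coords (ConeDichotomy.constantCoeff_linSubst M) (by rw [ConeDichotomy.linMat_linSubst]; exact hM) hu v

/-! ## One smooth germ as a coordinate: NC recognition -/

/-- The family `(x₀, …, g, …, x_{n−1})` — `g` in slot `i₀`, the other coordinates unchanged — has zero constant terms when `g(0) = 0`. -/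
theorem constantCoeff_update_X {n : ℕ} (i₀ : Fin n) {g : MvPowerSeries (Fin n) k} (hg0 : constantCoeff g = 0) (i : Fin n) :
    constantCoeff (Function.update X i₀ g i) = 0 := by
  by_cases hi : i = i₀
  · subst hi
    rw [Function.update_self]
    exact hg0
  · rw [Function.update_of_ne hi]
    exact constantCoeff_X i

/-- Its linear part is the identity matrix with row `i₀` replaced by the linear part of `g`. -/
theorem linMat_update_X {n : ℕ} (i₀ : Fin n) (g : MvPowerSeries (Fin n) k) :
    (Matrix.of fun i j => coeff (Finsupp.single j 1) (Function.update X i₀ g i)) =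
      (1 : Matrix (Fin n) (Fin n) k).updateRow i₀ (fun j => coeff (Finsupp.single j 1) g) := by
  ext i j
  rw [Matrix.of_apply, Matrix.updateRow_apply]
  by_cases hi : i = i₀
  · subst hi
    rw [Function.update_self, if_pos rfl]
  · rw [Function.update_of_ne hi, if_neg hi, coeff_X, Matrix.one_apply]
    by_cases hij : i = j
    · subst hij
      rw [if_pos rfl, if_pos rfl]
    · rw [if_neg (fun h => hij (Finsupp.single_left_injective one_ne_zero h).symm), if_neg hij]

/-- The identity matrix with row `i₀` replaced by `a` has determinant `a i₀` (Cramer). -/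
theorem det_one_updateRow {n : ℕ} (i₀ : Fin n) (a : Fin n → k) : ((1 : Matrix (Fin n) (Fin n) k).updateRow i₀ a).det = a i₀ := by
  rw [← Matrix.cramer_transpose_apply, Matrix.transpose_one, Matrix.cramer_one]
  rfl

/-- So the linear part of `(x₀, …, g, …, x_{n−1})` has determinant `∂g/∂x_{i₀}(0)`: the family is a legal coordinate change exactly when
`g` is of order `1` in `x_{i₀}`. -/
theorem det_linMat_update_X {n : ℕ} (i₀ : Fin n) (g : MvPowerSeries (Fin n) k) :
    Matrix.det (Matrix.of fun i j => coeff (Finsupp.single j 1) (Function.update X i₀ g i)) = coeff (Finsupp.single i₀ 1) g := by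
  rw [linMat_update_X, det_one_updateRow]

/-- **NC RECOGNITION** (OURS · L1 W4.3, rung R0 of the line `nc-game-transport`; the lemma the rungs R2/R1 consume): a germ `g` with
`g(0) = 0` and `∂g/∂x_{i₀}(0) ≠ 0`, times a unit `u` (`u(0) ≠ 0`), times a monomial in the OTHER variables (`v_{i₀} = 0`), to any powers,
has normal-crossing support: `GermIsNC (u · g^e · ∏ᵢ xᵢ^{vᵢ})`.  The normalising coordinates invert `(x₀, …, g, …, x_{n−1})`. -/
theorem germIsNC_of_smooth_mul_unitMonomial {n : ℕ} (i₀ : Fin n) {g u : MvPowerSeries (Fin n) k}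
    (hg0 : constantCoeff g = 0) (hg1 : coeff (Finsupp.single i₀ 1) g ≠ 0) (hu : constantCoeff u ≠ 0)
    (e : ℕ) {v : Fin n → ℕ} (hv : v i₀ = 0) :
    GermIsNC (u * g ^ e * ∏ i, X i ^ v i) := by
  have key : u * g ^ e * ∏ i, X i ^ v i = u * ∏ i, Function.update X i₀ g i ^ Function.update v i₀ e i := by
    rw [← Finset.mul_prod_erase Finset.univ (fun i => (X i : MvPowerSeries (Fin n) k) ^ v i) (Finset.mem_univ i₀),
      ← Finset.mul_prod_erase Finset.univ (fun i => Function.update X i₀ g i ^ Function.update v i₀ e i) (Finset.mem_univ i₀)]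
    simp only [Function.update_self, hv, pow_zero, one_mul, mul_assoc]
    congr 2
    refine Finset.prod_congr rfl fun i hi => ?_
    rw [Function.update_of_ne (Finset.ne_of_mem_erase hi), Function.update_of_ne (Finset.ne_of_mem_erase hi)]
  rw [key]
  refine germIsNC_unit_mul_prod_pow_coords (constantCoeff_update_X i₀ hg0) ?_ hu _
  rw [det_linMat_update_X]
  exact isUnit_iff_ne_zero.mpr hg1

/-! ## R0: powers of one smooth germ -/

/-- `order g = 1` unpacked: `g ≠ 0`, `g(0) = 0`, and some linear coefficient `∂g/∂xᵢ(0)` is non-zero. -/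
theorem exists_coeff_single_ne_zero_of_order_eq_one {n : ℕ} {g : MvPowerSeries (Fin n) k} (hg : g.order = 1) :
    g ≠ 0 ∧ constantCoeff g = 0 ∧ ∃ i, coeff (Finsupp.single i 1) g ≠ 0 := by
  have hg0 : g ≠ 0 := by
    rintro rfl
    rw [order_zero] at hg
    exact ENat.top_ne_one hg
  refine ⟨hg0, one_le_order_iff_constCoeff_eq_zero.mp hg.symm.le, ?_⟩
  obtain ⟨d, hd, hdeg⟩ := exists_coeff_ne_zero_and_order (ne_zero_iff_order_finite.mp hg0)
  rw [hg] at hdeg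
  have hdeg1 : d.degree = 1 := by exact_mod_cast hdeg
  rcases FormalCoordChange.eq_zero_or_single_of_degree_lt_two d (by omega) with rfl | ⟨i, rfl⟩
  · simp at hdeg1
  · exact ⟨i, hd⟩

/-- **R0 — POWERS OF ONE SMOOTH GERM ARE NC** (OURS · L1 W4.3, line `nc-game-transport`, rung R0): `order g = 1`, `u(0) ≠ 0` ⇒
`GermIsNC (u · g^e)` (any field, any number of variables). -/
theorem germIsNC_unit_mul_smoothPower {n : ℕ} {g u : MvPowerSeries (Fin n) k} (hg : g.order = 1) (hu : constantCoeff u ≠ 0) (e : ℕ) :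
    GermIsNC (u * g ^ e) := by
  obtain ⟨-, hg0, i₀, hg1⟩ := exists_coeff_single_ne_zero_of_order_eq_one hg
  have h := germIsNC_of_smooth_mul_unitMonomial i₀ hg0 hg1 hu e (v := 0) rfl
  simpa using h

/-- R0 in the count game's currency: `u · g^e` is won at depth `0` (`WinsIn GermIsNC 0`). -/
theorem winsIn_zero_smoothPower {m : ℕ} {g u : MvPowerSeries (Fin (m + 1)) k} (hg : g.order = 1) (hu : constantCoeff u ≠ 0) (e : ℕ) :
    WinsIn GermIsNC 0 (u * g ^ e) :=
  germIsNC_unit_mul_smoothPower hg hu e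

/-- THE RUNG R0 in the shape `∀ b ∈ 𝒞, ∃ n, WinsIn GermIsNC n b` of the line's TOT stubs, for the class 𝒞 = {unit · (smooth germ)^e}. -/
theorem exists_winsIn_smoothPower {m : ℕ} {g u : MvPowerSeries (Fin (m + 1)) k} (hg : g.order = 1) (hu : constantCoeff u ≠ 0) (e : ℕ) :
    ∃ n, WinsIn GermIsNC n (u * g ^ e) :=
  ⟨0, winsIn_zero_smoothPower hg hu e⟩

/-- `u · g^e ≠ 0` for `order g = 1`, `u(0) ≠ 0`. -/
theorem unit_mul_smoothPower_ne_zero {n : ℕ} {g u : MvPowerSeries (Fin n) k} (hg : g.order = 1) (hu : constantCoeff u ≠ 0) (e : ℕ) :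
    u * g ^ e ≠ 0 :=
  mul_ne_zero (fun h => hu (by rw [h, map_zero])) (pow_ne_zero e (exists_coeff_single_ne_zero_of_order_eq_one hg).1)

/-- R0 THROUGH THE TRANSPORT (depth `0`, `NCTransport.won_of_germIsNC`): every divisor `f` of a power of `u · g^e` (`order g = 1`,
`u(0) ≠ 0`) is in the winning region `CobordantGame.Won k (m + 1)` of the local weighted resolution game — any field. -/
theorem won_of_dvd_smoothPower_pow {m : ℕ} {g u : MvPowerSeries (Fin (m + 1)) k} (hg : g.order = 1) (hu : constantCoeff u ≠ 0)
    (e N : ℕ) (f : MvPowerSeries (Fin (m + 1)) k) (hf : f ∣ (u * g ^ e) ^ (N + 1)) : CobordantGame.Won k (m + 1) f :=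
  won_of_germIsNC (unit_mul_smoothPower_ne_zero hg hu e) (germIsNC_unit_mul_smoothPower hg hu e) N f hf

end NCTransport

end Summit.ResolutionOfSingularities.ResolutionOfSingularities.Theorems
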